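import Summits.ResolutionOfSingularities.ResolutionOfSingularities.Theorems.PurelyInseparableDim4Scope
import Mathlib.Order.WellFounded
import HarnessLib
import HarnessLib.Audit.Tags

/-!
# Purely inseparable fourfolds — F4-I from a measure: strict on translated edges, weak on the spine
# [OURS · counted 0 · a reduction inside OUR frame (`PurelyInseparableDim4Scope`), not about resolution]

Census cell «res-dim4-pi» (D-0157 DOOR 2), width seat `res-dim4-p-14`, brick PR-12j: the ASSEMBLY SHAPE
for the cell's TIER-1 (I) target F4-I `NoIsolatedTrap p q` (no infinite branch of point blow-ups through
ISOLATED `q`-fold points).  Two inputs are being produced by other seats: the SPINE HALF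
(ISO-SPINE-PO, idea-3 / p-9 `IsoSpine.noPointOnlySpineBranch` p650832: no infinite all-isolated branch
of chart-ORIGIN edges) and a MEASURE (`μ₂` = colength of `J₂⁺`, p-5's F4I-22-MU-DROP / idea-3's I-3-2 /
eng-w4's ISO-K: observed to drop on isolated→isolated edges at `p = 2`; at `p = 3` translated plateaus
exist, idea-3 P-3-3).  This DEF-FREE file proves how they combine, for any `p`, `q`:

* **`noIsolatedTrap_of_spine_and_measure`**: IF over every field of characteristic `p` (i) there is no
  infinite all-isolated branch of ORIGIN point-blow-up edges (`SpineEdge q univ`), and (ii) there is a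
  measure `μ : State K → W` into a well-ordered type (`LinearOrder`, `WellFoundedLT`: `ℕ`, lex powers,
  ordinals) that does NOT INCREASE on isolated→isolated origin edges and STRICTLY DECREASES on
  isolated→isolated TRANSLATED edges (`b ≠ 0`), THEN `NoIsolatedTrap p q`.  (A non-increasing sequence
  in a well-order is eventually constant, `eventually_const_of_succ_le`; after that every edge is an
  origin edge, contradicting (i).)  So the measure needs strictness only OFF the spine.
* `noIsolatedTrap_of_measure` — the plain form: a measure strictly decreasing on every
  isolated→isolated `Step0` edge suffices (no spine input).

Nothing here asserts that such a measure exists; nothing here proves resolution of singularities in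
dimension ≥ 4 / characteristic `p`; counted 0; AI work, weaker than expert review.
bears_on: LADDER-RESOLUTION:D157-DOOR2 (res-dim4-pi · PR-12j · F4-I assembly). Supports
stmt-ResolutionOfSingularities-16155 (helper).
-/

set_option linter.dupNamespace false

noncomputable section

namespace Summit.ResolutionOfSingularities.ResolutionOfSingularities.Theorems.PIDim4

namespace IsolatedMeasure

open Literature.AlgebraicGeometry.Resolution

/-! ## 1. A non-increasing sequence in a well-order is eventually constant -/

/-- In a linear order with well-founded `<`, a sequence with `a (k+1) ≤ a k` is eventually constant.
[folklore] -/
theorem eventually_const_of_succ_le {W : Type} [LinearOrder W] [WellFoundedLT W] (a : ℕ → W)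
    (ha : ∀ k, a (k + 1) ≤ a k) : ∃ N, ∀ k, N ≤ k → a k = a N := by
  have hanti : ∀ N k, a (N + k) ≤ a N := fun N k => by
    induction k with
    | zero => exact le_rfl
    | succ k ih => exact (ha (N + k)).trans ih
  obtain ⟨_, ⟨N, rfl⟩, hmin⟩ := wellFounded_lt.has_min (Set.range a) ⟨_, 0, rfl⟩
  refine ⟨N, fun k hk => ?_⟩
  obtain ⟨d, rfl⟩ := Nat.exists_eq_add_of_le hk
  exact le_antisymm (hanti N d) (not_lt.mp (hmin _ ⟨N + d, rfl⟩))

/-! ## 2. The assembly: spine half + off-spine measure ⇒ F4-I -/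

/-- **F4-I from the SPINE HALF and an OFF-SPINE MEASURE.**  Hypotheses, over every field of
characteristic `p`: (i) no infinite branch of isolated states along chart-ORIGIN point-blow-up edges;
(ii) a well-ordered measure that does not increase along isolated→isolated origin edges and strictly
decreases along isolated→isolated translated edges (`b ≠ 0`, `b_j = 0`).  Conclusion:
`NoIsolatedTrap p q`. [OURS · assembly shape] [folklore] -/
theorem noIsolatedTrap_of_spine_and_measure (p q : ℕ)
    (hspine : ∀ (K : Type) [Field K] [CharP K p] [DecidableEq K],
      ¬ ∃ c : ℕ → State K, ∀ k, IsIsolated q (c k).F ∧ SpineEdge q Finset.univ (c k) (c (k + 1)))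
    (hμ : ∀ (K : Type) [Field K] [CharP K p] [DecidableEq K],
      ∃ (W : Type) (_ : LinearOrder W) (_ : WellFoundedLT W) (μ : State K → W),
        (∀ (s : State K) (j : Fin 4), IsIsolated q s.F →
            IsIsolated q (CentreBlowup.step q Finset.univ j (0 : Fin 4 → K) s).F →
            CentreBlowup.IsEquimultiplePoint q Finset.univ j (0 : Fin 4 → K) s →
            (CentreBlowup.step q Finset.univ j (0 : Fin 4 → K) s).F ≠ 0 →
            μ (CentreBlowup.step q Finset.univ j (0 : Fin 4 → K) s) ≤ μ s) ∧
        (∀ (s : State K) (j : Fin 4) (b : Fin 4 → K), b ≠ 0 → b j = 0 → IsIsolated q s.F →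
            IsIsolated q (CentreBlowup.step q Finset.univ j b s).F →
            CentreBlowup.IsEquimultiplePoint q Finset.univ j b s →
            (CentreBlowup.step q Finset.univ j b s).F ≠ 0 →
            μ (CentreBlowup.step q Finset.univ j b s) < μ s)) :
    NoIsolatedTrap p q := by
  intro K _ _ _
  rintro ⟨c, hc⟩
  obtain ⟨W, _, _, μ, hle, hlt⟩ := hμ K
  -- the measure along the branch does not increase
  have hmono : ∀ k, μ (c (k + 1)) ≤ μ (c k) := fun k => by
    obtain ⟨hiso, -, j, b, -, hbj, heq, hne, hck⟩ := hc k
    have hiso' : IsIsolated q (CentreBlowup.step q Finset.univ j b (c k)).F := by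
      rw [← hck]; exact (hc (k + 1)).1
    by_cases hb : b = 0
    · subst hb
      rw [hck]
      exact hle (c k) j hiso hiso' heq hne
    · rw [hck]
      exact le_of_lt (hlt (c k) j b hb hbj hiso hiso' heq hne)
  -- hence it is eventually constant, and from then on every edge is an ORIGIN edge
  obtain ⟨N, hN⟩ := eventually_const_of_succ_le (fun k => μ (c k)) hmono
  apply hspine K
  refine ⟨fun k => c (N + k), fun k => ⟨(hc (N + k)).1, ?_⟩⟩
  obtain ⟨hiso, -, j, b, -, hbj, heq, hne, hck⟩ := hc (N + k)
  have hiso' : IsIsolated q (CentreBlowup.step q Finset.univ j b (c (N + k))).F := by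
    rw [← hck]; exact (hc (N + k + 1)).1
  by_cases hb : b = 0
  · subst hb
    exact ⟨j, Finset.mem_univ j, heq, hne, by rw [Nat.add_succ]; exact hck⟩
  · exfalso
    have h1 : μ (c (N + k + 1)) = μ (c N) := hN (N + k + 1) (by omega)
    have h2 : μ (c (N + k)) = μ (c N) := hN (N + k) (by omega)
    have h3 := hlt (c (N + k)) j b hb hbj hiso hiso' heq hne
    rw [← hck, h1, h2] at h3
    exact lt_irrefl _ h3

/-- **F4-I from a strict measure** (plain form): a well-ordered measure strictly decreasing along every
isolated→isolated point-blow-up edge gives `NoIsolatedTrap p q`. [OURS · assembly shape] [folklore] -/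
theorem noIsolatedTrap_of_measure (p q : ℕ)
    (hμ : ∀ (K : Type) [Field K] [CharP K p] [DecidableEq K],
      ∃ (W : Type) (_ : LinearOrder W) (_ : WellFoundedLT W) (μ : State K → W),
        ∀ s s' : State K, IsIsolated q s.F → IsIsolated q s'.F → Step0 q s s' → μ s' < μ s) :
    NoIsolatedTrap p q := by
  intro K _ _ _
  rintro ⟨c, hc⟩
  obtain ⟨W, _, _, μ, hlt⟩ := hμ K
  have hdec : ∀ k, μ (c (k + 1)) < μ (c k) := fun k =>
    hlt _ _ (hc k).1 (hc (k + 1)).1 (hc k).2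
  obtain ⟨_, ⟨k, rfl⟩, hmin⟩ := wellFounded_lt.has_min (Set.range fun k => μ (c k)) ⟨_, 0, rfl⟩
  exact hmin _ ⟨k + 1, rfl⟩ (hdec k)

end IsolatedMeasure

end Summit.ResolutionOfSingularities.ResolutionOfSingularities.Theorems.PIDim4

end
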